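import Literature.Computability.Complexity.FoldBricks
import Literature.Computability.Complexity.PlumbingBricks
import Literature.Computability.Complexity.IterateFPPoly
import HarnessLib

/-!
# Capped loop bodies: counted loops in `FP` without growth bookkeeping on malformed records

Toolkit in the brick algebra of `BrickAlgebra.lean` / `IterateFPPoly.lean`. The
counted-loop lemma `Brick.loopFn_mem_FP_of_poly` puts `z ↦ (loopStep body)^[p |fstF z|] z` in `FP`
for a body whose output obeys `|body z| ≤ |sndPow 1 z| + G(|fstF z|)` on EVERY record `z` — the new
state may exceed the old one by a polynomial of the yardstick (the kept first field). For a body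
assembled from many bricks (a round of an oracle-replaying search: rational arithmetic, matrix
codes, transcript surgery) that inequality is easy on the records the machine actually produces —
there it is an absolute size invariant of the algorithm — and tiresome on garbage. `FoldBricks.clipF`
removes the garbage case for ABSOLUTELY (linearly) bounded outputs by truncating them, and
`CodeFP.rcapF` (`CodeFP.lean`) truncates at an absolute polynomial bound; this file does the same for
the RELATIVE, polynomial bound of loop bodies, by idling instead of truncating:

* `Brick.rcapF G body z` — `body z` if `|body z| ≤ |sndPow 1 z| + G(|fstF z|)`, else the old state
  `sndPow 1 z` (a one-bit length comparison against a padded copy of the state, `ltLenF`);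
* `length_rcapF_le` (the growth bound, on every input), `rcapF_eq_self` (no effect where the bound
  holds), `rcapF_mem_FP`, and **`loopFn_rcapF_mem_FP`**: the counted loop of a capped `FP` body is in
  `FP` with no hypothesis on the body's growth;
* `loopModel_rcapF_of_invariant` — the model of the capped loop is the model of the loop from every
  state of an invariant set on which the body obeys the bound (the form in which a size invariant of
  the algorithm is consumed), `loopModel_rcapF_succ` (one round);
* `iterate_const_mem_FP` — constantly many rounds of an `FP` function are in `FP` (unrolled loops of
  constant trip count need no yardstick at all).

## References

* S. Arora, B. Barak, *Computational Complexity: A Modern Approach*, CUP 2009, §1.3 (polynomial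
  time is closed under composition and polynomially bounded loops), §1.4.1 (clocked simulation).
  (Standard; fully proved here.)
-/

namespace Literature.Computability.Complexity

open _root_.Computability Polynomial Plumb

namespace Brick

/-! ### The cap -/

/-- The length test of the cap: `[|body z| < |sndPow 1 z| + (G + 1)(|fstF z|)]`, comparing against the
state padded with `1^{(G+1)(|fstF z|)}`. [folklore] -/
noncomputable def rcapTest (G : Polynomial ℕ) (body : List Bool → List Bool) : List Bool → List Bool :=
  ltLenF ∘ fanoutFn body (appF ∘ fanoutFn (sndPow 1) (polyFn (G + 1) ∘ fstF))

/-- Value of the length test. [folklore] -/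
theorem rcapTest_apply (G : Polynomial ℕ) (body : List Bool → List Bool) (z : List Bool) :
    rcapTest G body z = [decide ((body z).length < (sndPow 1 z).length + (G.eval (fstF z).length + 1))] := by
  simp [rcapTest, ones]

/-- The length test is one-bit. [folklore] -/
theorem oneBit_rcapTest (G : Polynomial ℕ) (body : List Bool → List Bool) : OneBit (rcapTest G body) := fun z =>
  ⟨_, rcapTest_apply G body z⟩

/-- `rcapTest G body ∈ FP` for `body ∈ FP`. [cite: AroraBarak2009, §1.3] -/
theorem rcapTest_mem_FP (G : Polynomial ℕ) {body : List Bool → List Bool} (hb : body ∈ FP) : rcapTest G body ∈ FP :=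
  comp_mem_FP ltLenF_mem_FP (fanoutFn_mem_FP hb (comp_mem_FP appF_mem_FP (fanoutFn_mem_FP (sndPow_mem_FP 1)
    (comp_mem_FP (polyFn_mem_FP _) fstF_mem_FP))))

/-- **The capped body**: `body z` if it is at most `G(|fstF z|)` longer than the state `sndPow 1 z` of
the loop record `z = ⟨x, ⟨counter, state⟩⟩`, else the state unchanged. [cite: AroraBarak2009, §1.3] -/
noncomputable def rcapF (G : Polynomial ℕ) (body : List Bool → List Bool) : List Bool → List Bool :=
  iteFn (rcapTest G body) body (sndPow 1)

/-- Value of the capped body. [folklore] -/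
theorem rcapF_apply (G : Polynomial ℕ) (body : List Bool → List Bool) (z : List Bool) :
    rcapF G body z = if (body z).length ≤ (sndPow 1 z).length + G.eval (fstF z).length then body z else sndPow 1 z := by
  rw [rcapF, iteFn_of_oneBit (oneBit_rcapTest G body), rcapTest_apply]
  by_cases h : (body z).length ≤ (sndPow 1 z).length + G.eval (fstF z).length
  · rw [if_pos h, if_pos (by simp; omega)]
  · rw [if_neg h, if_neg (by simp; omega)]

/-- **The growth bound of the capped body, on every input.** [folklore] -/
theorem length_rcapF_le (G : Polynomial ℕ) (body : List Bool → List Bool) (z : List Bool) :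
    (rcapF G body z).length ≤ (sndPow 1 z).length + G.eval (fstF z).length := by
  rw [rcapF_apply]
  split_ifs with h
  · exact h
  · omega

/-- **The cap has no effect where the bound holds.** [folklore] -/
theorem rcapF_eq_self {G : Polynomial ℕ} {body : List Bool → List Bool} {z : List Bool}
    (h : (body z).length ≤ (sndPow 1 z).length + G.eval (fstF z).length) : rcapF G body z = body z := by
  rw [rcapF_apply, if_pos h]

/-- On a loop record: the cap compares with the state and the yardstick. [folklore] -/
theorem rcapF_record {G : Polynomial ℕ} {body : List Bool → List Bool} {x c s : List Bool}
    (h : (body (boolPair x (boolPair c s))).length ≤ s.length + G.eval x.length) :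
    rcapF G body (boolPair x (boolPair c s)) = body (boolPair x (boolPair c s)) :=
  rcapF_eq_self (by simpa using h)

/-- `rcapF G body ∈ FP` for `body ∈ FP`. [cite: AroraBarak2009, §1.3] -/
theorem rcapF_mem_FP (G : Polynomial ℕ) {body : List Bool → List Bool} (hb : body ∈ FP) : rcapF G body ∈ FP :=
  iteFn_mem_FP (rcapTest_mem_FP G hb) hb (sndPow_mem_FP 1)

/-- **Counted loops of capped bodies are in `FP`, unconditionally**:
`z ↦ (loopStep (rcapF G body))^[p |fstF z|] z ∈ FP` for every `body ∈ FP`. [cite: AroraBarak2009, §1.3 (bounded loops), §1.4.1] -/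
theorem loopFn_rcapF_mem_FP {body : List Bool → List Bool} (hb : body ∈ FP) (G p : Polynomial ℕ) :
    (fun z => (loopStep (rcapF G body))^[p.eval (fstF z).length] z) ∈ FP :=
  loopFn_mem_FP_of_poly (rcapF_mem_FP G hb) G (length_rcapF_le G body) p

/-! ### The model of a capped loop -/

/-- **The capped loop follows the loop while the bound holds**: stated one round at a time — if the
body stays within the bound on the record with counter `k + 1` and state `s`, the capped model from
`(k + 1, s)` is the body's step followed by the capped model from `k`. [folklore] -/
theorem loopModel_rcapF_succ {G : Polynomial ℕ} {body : List Bool → List Bool} {x : List Bool} (k : ℕ) (s : List Bool)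
    (h : (body (boolPair x (boolPair (encodeNat (k + 1)) s))).length ≤ s.length + G.eval x.length) :
    loopModel (rcapF G body) x (k + 1) s = loopModel (rcapF G body) x k (body (boolPair x (boolPair (encodeNat (k + 1)) s))) := by
  rw [loopModel, rcapF_record h]

/-- If the body keeps a set of states invariant and obeys the bound on it, the capped model agrees
with the model from every invariant state. [folklore] -/
theorem loopModel_rcapF_of_invariant {G : Polynomial ℕ} {body : List Bool → List Bool} {x : List Bool}
    (P : List Bool → Prop)
    (hstep : ∀ (k : ℕ) (s : List Bool), P s → P (body (boolPair x (boolPair (encodeNat (k + 1)) s))))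
    (hbd : ∀ (k : ℕ) (s : List Bool), P s → (body (boolPair x (boolPair (encodeNat (k + 1)) s))).length ≤ s.length + G.eval x.length) :
    ∀ (k : ℕ) (s : List Bool), P s → loopModel (rcapF G body) x k s = loopModel body x k s
  | 0, s, _ => rfl
  | k + 1, s, hs => by
    rw [loopModel_rcapF_succ k s (hbd k s hs), loopModel]
    exact loopModel_rcapF_of_invariant P hstep hbd k _ (hstep k s hs)

/-! ### Constantly many rounds -/

/-- **Constantly many rounds of an `FP` function are in `FP`.** [cite: AroraBarak2009, §1.3] -/
theorem iterate_const_mem_FP {f : List Bool → List Bool} (hf : f ∈ FP) : ∀ k : ℕ, (f^[k]) ∈ FP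
  | 0 => OracleCompose.id_mem_FP
  | k + 1 => by rw [Function.iterate_succ']; exact comp_mem_FP hf (iterate_const_mem_FP hf k)

end Brick

end Literature.Computability.Complexity
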